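import Literature.Probability.RandomPlanarGeometry.SLEDerivRatioMartingaleProofs
import Literature.Probability.RandomPlanarGeometry.SLEBoundaryHittingProofs
import HarnessLib

/-!
# Rohde–Schramm's Theorem 6.4 for `κ ≥ 8`: no point of `ℍ` is swallowed

Topic `Probability/RandomPlanarGeometry`; theorems only, nothing is redefined and no named fact is
introduced. S. Rohde, O. Schramm, *Basic properties of SLE*, Ann. of Math. 161 (2005), p. 906:
"We say that `z ∈ ℍ̄` is swallowed by the SLE if `z ∉ γ[0, ∞)` but `z ∈ Kₜ` for some
`t ∈ (0, ∞)`. … **Theorem 6.4.** … If `κ ∉ (4, 8)`, then a.s. no `z ∈ ℍ̄ ∖ {0}` is swallowed."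
The first half of Thm. 6.4 (`κ ∈ (4, 8)`: every point is swallowed) is the named fact
`ae_isSwallowed_sleTrace` of `CritPercSLE.lean`; the second half was not in the tree. This file
**proves** it for `κ ≥ 8` and points of the open half-plane, one `κ` at a time and, as in the
source (where `γ` is the path given by Thm. 5.1, resp. by [LSW] at `κ = 8`), under the hypothesis
that SLE_κ is a.s. generated by a curve (`HasSLETrace κ`):

* `ae_tendsto_infDist_compl_domain_of_eight_le` (**proved**, no trace needed): for `κ ≥ 8` and
  `z ∈ ℍ`, almost surely `dist(z, ∂Hₜ) → 0` as `t ↑ τ(z)` — Lemma 6.3 for `κ ≥ 8`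
  (`tendsto_sleDerivRatio_atTop_of_eight_le_holds`, proved in `SLEDerivRatioMartingaleProofs`:
  `(Im z) |gₜ'(z)| / Im gₜ(z) → ∞`) combined with the Schwarz bound of eq. (6.2),
  `dist(z, ∂Hₜ) |gₜ'(z)| ≤ 2 Im gₜ(z)` (`Loewner.infDist_compl_domain_mul_norm_deriv_map_le`). This is
  the display "(dtz)" after eq. (6.2), p. 903, in the case `Z(z) = ∞`.
* `ae_forall_mem_image_sleTrace_of_mem_sleHull` (**proved**, fixed `z ∈ ℍ`, `κ ≥ 8`,
  `HasSLETrace κ`): almost surely, for every `t`, if `z ∈ Kₜ` then `z ∈ γ[0, t]`. Printed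
  argument (p. 907): "suppose that `z₀` is swallowed, and let `t₀` be the swallowing time. If
  `δ > 0` is smaller than the distance from `z₀` to `γ[0, t₀]`, then all the points within distance
  `δ` from `z₀` are swallowed with `z₀`" — i.e. `dist(z₀, ∂Hₜ) ≥ δ` for all `t < τ(z₀)`
  (`Loewner.IsGeneratedByCurve.infDist_le_infDist_compl_domain`), contradicting the first item.
* `ae_forall_sleHull_subset_image_sleTrace` and `ae_forall_sleHull_eq_of_eight_le` (**proved**,
  `κ ≥ 8`, `HasSLETrace κ`): almost surely, **for all `t` simultaneously**,
  `Kₜ = ℍ ∩ γ[0, t]` — the hulls of SLE_κ, `κ ≥ 8`, have no bubbles: a bounded component of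
  `ℍ ∖ γ[0, t]` is open, hence contains a point of a fixed countable dense set, which would be
  swallowed ("by (dtz) there is some `z₀` such that `P[Z(z₀) < ∞] > 0`", p. 907). Consequences:
  `ae_forall_mem_range_sleTrace_of_mem_sleHull` (Thm. 6.4, second half, for `z ∈ ℍ`: a.s. no
  point of `ℍ` is swallowed) and `ae_forall_domain_eq_of_eight_le` (`Hₜ = ℍ ∖ γ[0, t]`).

Not covered here: real points `z ∈ ℝ ∖ {0}` (the tree's hulls are subsets of the open
half-plane; the boundary statement is about swallowing times of real points) and `κ ≤ 4`
(where the statement is part of Thm. 6.1). These theorems are the first input ("we know from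
Theorem 6.4 and Lemma 6.5 that a.s. `z₀ ∈ γ[0, ∞)`") of the printed proof of Lemma 7.3 for
`κ > 8` (p. 910), on which the `κ > 8` and `κ = 8` cases of the transience theorem
`tendsto_norm_sleTrace_atTop` (Thm. 7.1) still rest.

## References

* S. Rohde, O. Schramm, *Basic properties of SLE*, Ann. of Math. 161 (2005) 883–924: Lemma 6.3
  and eq. (6.2) (p. 903), Thm. 6.4 and its proof (pp. 906–907), Lemma 7.3 (p. 910).
-/

noncomputable section

open Set Filter Topology MeasureTheory Metric Bornology Complex
open UpperHalfPlane (upperHalfPlaneSet isOpen_upperHalfPlaneSet)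
open scoped NNReal

namespace Literature.Probability.RandomPlanarGeometry

/-! ### Deterministic bounds -/

namespace Loewner

variable {W : ℝ≥0 → ℝ} {γ : ℝ≥0 → ℂ}

/-- **The derivative ratio is controlled by the distance to the boundary**: for a continuous
driving function, `z ∈ Hₜ` and `0 < δ ≤ dist(z, Hₜᶜ)`,
`(Im z) |gₜ'(z)| / Im gₜ(z) ≤ 2 (Im z) / δ` — eq. (6.2) of Rohde–Schramm (2005)
(`infDist_compl_domain_mul_norm_deriv_map_le`) rearranged. [cite: RohdeSchramm2005, eq. (6.2)] -/
theorem im_mul_norm_deriv_map_div_le (hW : Continuous W) {t : ℝ≥0} {z : ℂ} (hz : z ∈ domain W t)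
    {δ : ℝ} (hδ : 0 < δ) (hle : δ ≤ infDist z (domain W t)ᶜ) :
    z.im * ‖deriv (map W t) z‖ / (map W t z).im ≤ 2 * z.im / δ := by
  have him : 0 < (map W t z).im := mapsTo_map hW t hz
  have hzim : 0 < z.im := domain_subset W t hz
  have h2 := infDist_compl_domain_mul_norm_deriv_map_le hW hz
  have h1 : δ * ‖deriv (map W t) z‖ ≤ 2 * (map W t z).im :=
    (mul_le_mul_of_nonneg_right hle (norm_nonneg _)).trans h2
  rw [div_le_div_iff₀ him hδ]
  nlinarith [hzim.le, norm_nonneg (deriv (map W t) z)]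

/-- For a chain generated by `γ`, `t ≤ t₀` and `z ∈ Hₜ`:
`dist(z, γ[0, t₀] ∪ ℝ) ≤ dist(z, γ[0, t] ∪ ℝ) ≤ dist(z, Hₜᶜ)` (`infDist_le_infDist_compl_domain`).
This is "all the points within distance `δ` from `z₀` are swallowed with `z₀`" in the proof of
Rohde–Schramm (2005), Thm. 6.4 (p. 907): before its swallowing time a point off `γ[0, t₀]` stays
at distance `≥ dist(z, γ[0, t₀] ∪ ℝ)` from `∂Hₜ`. [cite: RohdeSchramm2005, Thm 6.4 (proof)] -/
theorem IsGeneratedByCurve.infDist_image_le_infDist_compl_domain (h : IsGeneratedByCurve W γ)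
    {t t₀ : ℝ≥0} (ht : t ≤ t₀) {z : ℂ} (hz : z ∈ domain W t) :
    infDist z (γ '' Icc 0 t₀ ∪ {w : ℂ | w.im = 0}) ≤ infDist z (domain W t)ᶜ := by
  have hsub : γ '' Icc 0 t ∪ {w : ℂ | w.im = 0} ⊆ γ '' Icc 0 t₀ ∪ {w : ℂ | w.im = 0} :=
    union_subset_union_left _ (image_mono (Icc_subset_Icc_right ht))
  have hne : (γ '' Icc 0 t ∪ {w : ℂ | w.im = 0}).Nonempty :=
    ⟨γ 0, Or.inl ⟨0, ⟨le_rfl, bot_le⟩, rfl⟩⟩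
  exact (infDist_le_infDist_of_subset hsub hne).trans (h.infDist_le_infDist_compl_domain hz)

/-- The set `γ[0, t₀] ∪ ℝ` is closed, and a point of `ℍ` off `γ[0, t₀]` is at positive distance
from it. [folklore] -/
theorem IsGeneratedByCurve.infDist_image_pos (h : IsGeneratedByCurve W γ) {t₀ : ℝ≥0} {z : ℂ}
    (hz : z ∈ upperHalfPlaneSet) (hzγ : z ∉ γ '' Icc 0 t₀) :
    0 < infDist z (γ '' Icc 0 t₀ ∪ {w : ℂ | w.im = 0}) := by
  have hcl : IsClosed (γ '' Icc 0 t₀ ∪ {w : ℂ | w.im = 0}) :=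
    (isCompact_Icc.image h.continuous).isClosed.union
      (isClosed_eq Complex.continuous_im continuous_const)
  have hne : (γ '' Icc 0 t₀ ∪ {w : ℂ | w.im = 0}).Nonempty :=
    ⟨γ 0, Or.inl ⟨0, ⟨le_rfl, bot_le⟩, rfl⟩⟩
  refine (hcl.notMem_iff_infDist_pos hne).1 fun hmem ↦ ?_
  rcases hmem with hmem | hmem
  · exact hzγ hmem
  · have hzim : 0 < z.im := hz
    rw [show z.im = 0 from hmem] at hzim
    exact lt_irrefl _ hzim

end Loewner

/-! ### Lemma 6.3 (`κ ≥ 8`) in metric form: the hull comes arbitrarily close before `τ(z)` -/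

variable {κ : ℝ≥0} {z : ℂ}

open Loewner

/-- **`dist(z, ∂Hₜ) → 0` as `t ↑ τ(z)`, for `κ ≥ 8` and fixed `z ∈ ℍ`** (Rohde–Schramm (2005),
display (dtz) after eq. (6.2), p. 903, in the case `Z(z) = ∞` of Lemma 6.3): almost surely,
along the times `t < τ(z)` the distance from `z` to the complement of the Loewner domain `Hₜ`
tends to `0`. From Lemma 6.3 for `κ ≥ 8` (`tendsto_sleDerivRatio_atTop_of_eight_le_holds`) and
`(Im z) |gₜ'(z)| / Im gₜ(z) ≤ 2 Im z / dist(z, Hₜᶜ)` (`Loewner.im_mul_norm_deriv_map_div_le`). No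
trace is needed. [cite: RohdeSchramm2005, Lemma 6.3 and eq. (6.2)] -/
theorem ae_tendsto_infDist_compl_domain_of_eight_le (hκ : 8 ≤ κ) (hz : z ∈ upperHalfPlaneSet) :
    ∀ᵐ ω ∂Process.preWienerMeasure,
      Tendsto
        (fun t : {t : ℝ≥0 // (t : WithTop ℝ≥0) < swallowingTime (sleDriving κ ω) z} ↦
          infDist z (domain (sleDriving κ ω) t)ᶜ)
        atTop (𝓝 0) := by
  filter_upwards [tendsto_sleDerivRatio_atTop_of_eight_le_holds hκ z hz] with ω hT
  have hW : Continuous (sleDriving κ ω) := continuous_sleDriving κ ω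
  have hzim : 0 < z.im := hz
  rw [tendsto_order]
  refine ⟨fun a ha ↦ Eventually.of_forall fun t ↦ ha.trans_le infDist_nonneg, fun ε hε ↦ ?_⟩
  filter_upwards [hT.eventually_gt_atTop (2 * z.im / ε)] with t ht
  by_contra hge
  rw [not_lt] at hge
  have hzdom : z ∈ domain (sleDriving κ ω) t := (mem_domain_iff _ _ _).2 ⟨hz, t.2⟩
  have hle : sleDerivRatio κ ω z t ≤ 2 * z.im / ε := by
    rw [sleDerivRatio_apply]
    exact im_mul_norm_deriv_map_div_le hW hzdom hε hge
  exact (lt_irrefl _) (ht.trans_le hle)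

/-! ### Theorem 6.4, second half, for `κ ≥ 8`: a fixed point is not swallowed -/

/-- **A fixed point of `ℍ` is a.s. not swallowed (`κ ≥ 8`).** Let `κ ≥ 8` and let SLE_κ be a.s.
generated by a curve. For `z ∈ ℍ`, almost surely: for every `t`, if `z ∈ Kₜ` then
`z ∈ γ[0, t]`. Printed proof (Rohde–Schramm (2005), p. 907): if `z ∈ K_{t}` but `z ∉ γ[0, t]`,
then `δ := dist(z, γ[0, t] ∪ ℝ) > 0` and `dist(z, ∂Hₛ) ≥ δ` for all `s < τ(z) ≤ t`
(`Loewner.IsGeneratedByCurve.infDist_image_le_infDist_compl_domain`), so the ratio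
`(Im z)|gₛ'(z)|/Im gₛ(z)` stays `≤ 2 Im z / δ`, contradicting Lemma 6.3 (`Z(z) = ∞` for `κ ≥ 8`).
[cite: RohdeSchramm2005, Thm 6.4] -/
theorem ae_forall_mem_image_sleTrace_of_mem_sleHull (hγ : HasSLETrace κ) (hκ : 8 ≤ κ)
    (hz : z ∈ upperHalfPlaneSet) :
    ∀ᵐ ω ∂Process.preWienerMeasure, ∀ t : ℝ≥0, z ∈ sleHull κ ω t → z ∈ sleTrace κ ω '' Icc 0 t := by
  filter_upwards [ae_isGeneratedByCurve_sleTrace hγ,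
    tendsto_sleDerivRatio_atTop_of_eight_le_holds hκ z hz] with ω hg hT
  intro t₀ hzK
  by_contra hzγ
  have hW : Continuous (sleDriving κ ω) := continuous_sleDriving κ ω
  set δ : ℝ := infDist z (sleTrace κ ω '' Icc 0 t₀ ∪ {w : ℂ | w.im = 0}) with hδ_def
  have hδ : 0 < δ := hg.infDist_image_pos hz hzγ
  have hτ : swallowingTime (sleDriving κ ω) z ≤ t₀ := hzK.2
  -- before `τ(z)` the ratio is bounded by `2 Im z / δ`
  have hbound : ∀ t : {t : ℝ≥0 // (t : WithTop ℝ≥0) < swallowingTime (sleDriving κ ω) z},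
      sleDerivRatio κ ω z t ≤ 2 * z.im / δ := by
    rintro ⟨t, ht⟩
    have htt₀ : t ≤ t₀ := WithTop.coe_le_coe.1 (ht.le.trans hτ)
    have hzdom : z ∈ domain (sleDriving κ ω) t := (mem_domain_iff _ _ _).2 ⟨hz, ht⟩
    rw [sleDerivRatio_apply]
    exact im_mul_norm_deriv_map_div_le hW hzdom hδ
      (hg.infDist_image_le_infDist_compl_domain htt₀ hzdom)
  -- which contradicts Lemma 6.3 (`κ ≥ 8`)
  haveI : Nonempty {t : ℝ≥0 // (t : WithTop ℝ≥0) < swallowingTime (sleDriving κ ω) z} :=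
    ⟨⟨0, swallowingTime_pos_holds hW (ne_driving_of_im_pos hz 0)⟩⟩
  obtain ⟨t, ht⟩ := (hT.eventually_gt_atTop (2 * z.im / δ)).exists
  exact absurd ht (not_lt.2 (hbound t))

/-! ### Theorem 6.4, second half, for `κ ≥ 8`: all times and all points simultaneously -/

/-- **The hulls of SLE_κ, `κ ≥ 8`, have no bubbles**: if SLE_κ is a.s. generated by a curve,
then almost surely `Kₜ ⊆ γ[0, t]` for every `t` simultaneously. A bounded component of
`ℍ ∖ γ[0, t]` is open (`IsOpen.connectedComponentIn`), hence contains a point of a fixed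
countable dense subset of `ℍ`; that point lies in `Kₜ` (`IsGeneratedByCurve.mem_hull_iff`) but
off `γ[0, t]`, which `ae_forall_mem_image_sleTrace_of_mem_sleHull` forbids almost surely for all
points of the countable set at once. Rohde–Schramm (2005), proof of Thm. 6.4 (p. 907: swallowed
points come in discs, so "there is some `z₀`" in a countable set which is swallowed with
positive probability). [cite: RohdeSchramm2005, Thm 6.4] -/
theorem ae_forall_sleHull_subset_image_sleTrace (hγ : HasSLETrace κ) (hκ : 8 ≤ κ) :
    ∀ᵐ ω ∂Process.preWienerMeasure, ∀ t : ℝ≥0, sleHull κ ω t ⊆ sleTrace κ ω '' Icc 0 t := by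
  obtain ⟨D, hDsub, hDc, hDd⟩ :=
    (TopologicalSpace.IsSeparable.of_separableSpace upperHalfPlaneSet).exists_countable_dense_subset
  have hD : ∀ᵐ ω ∂Process.preWienerMeasure, ∀ d ∈ D, ∀ t : ℝ≥0,
      d ∈ sleHull κ ω t → d ∈ sleTrace κ ω '' Icc 0 t :=
    (ae_ball_iff hDc).2 fun d hd ↦ ae_forall_mem_image_sleTrace_of_mem_sleHull hγ hκ (hDsub hd)
  filter_upwards [ae_isGeneratedByCurve_sleTrace hγ, hD] with ω hg hω
  intro t z hzK
  by_contra hzγ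
  have hzH : z ∈ upperHalfPlaneSet := hzK.1
  set U : Set ℂ := upperHalfPlaneSet \ sleTrace κ ω '' Icc 0 t with hU_def
  have hU : IsOpen U :=
    isOpen_upperHalfPlaneSet.sdiff (isCompact_Icc.image hg.continuous).isClosed
  have hb : IsBounded (connectedComponentIn U z) := (hg.mem_hull_iff hzH hzγ).1 hzK
  have hCopen : IsOpen (connectedComponentIn U z) := hU.connectedComponentIn
  have hzC : z ∈ connectedComponentIn U z := mem_connectedComponentIn ⟨hzH, hzγ⟩
  have hCsub : connectedComponentIn U z ⊆ closure D :=
    ((connectedComponentIn_subset U z).trans sdiff_subset).trans hDd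
  have hne : (D ∩ connectedComponentIn U z).Nonempty := by
    rw [← closure_inter_open_nonempty_iff hCopen]
    exact ⟨z, hCsub hzC, hzC⟩
  obtain ⟨d, hdD, hdC⟩ := hne
  have hdU : d ∈ U := connectedComponentIn_subset U z hdC
  have heq : connectedComponentIn U d = connectedComponentIn U z :=
    (connectedComponentIn_eq hdC).symm
  have hdK : d ∈ sleHull κ ω t := (hg.mem_hull_iff hdU.1 hdU.2).2 (heq ▸ hb)
  exact hdU.2 (hω d hdD t hdK)

/-- **`Kₜ = ℍ ∩ γ[0, t]` for all `t`, almost surely (`κ ≥ 8`, `HasSLETrace κ`)**: the hull is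
exactly the part of the curve run so far that lies in the open half-plane
(`ae_forall_sleHull_subset_image_sleTrace` and `IsGeneratedByCurve.mem_hull_of_mem_image`).
[cite: RohdeSchramm2005, Thm 6.4] -/
theorem ae_forall_sleHull_eq_of_eight_le (hγ : HasSLETrace κ) (hκ : 8 ≤ κ) :
    ∀ᵐ ω ∂Process.preWienerMeasure, ∀ t : ℝ≥0,
      sleHull κ ω t = upperHalfPlaneSet ∩ sleTrace κ ω '' Icc 0 t := by
  filter_upwards [ae_isGeneratedByCurve_sleTrace hγ, ae_forall_sleHull_subset_image_sleTrace hγ hκ]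
    with ω hg hω
  intro t
  refine Subset.antisymm (fun z hz ↦ ⟨hz.1, hω t hz⟩) ?_
  rintro z ⟨hzH, hzγ⟩
  exact hg.mem_hull_of_mem_image hzH hzγ

/-- **Rohde–Schramm (2005), Thm. 6.4, second half, for `κ ≥ 8` and points of `ℍ`**: if SLE_κ
is a.s. generated by a curve, then almost surely no point of `ℍ` is swallowed — every point of
`ℍ` that belongs to some hull `Kₜ` lies on the trace (indeed on `γ[0, t]`).
[cite: RohdeSchramm2005, Thm 6.4] -/
theorem ae_forall_mem_range_sleTrace_of_mem_sleHull (hγ : HasSLETrace κ) (hκ : 8 ≤ κ) :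
    ∀ᵐ ω ∂Process.preWienerMeasure, ∀ (w : ℂ) (t : ℝ≥0),
      w ∈ sleHull κ ω t → w ∈ range (sleTrace κ ω) := by
  filter_upwards [ae_forall_sleHull_subset_image_sleTrace hγ hκ] with ω hω
  intro w t hw
  exact image_subset_range _ _ (hω t hw)

/-- **`Hₜ = ℍ ∖ γ[0, t]` for all `t`, almost surely (`κ ≥ 8`, `HasSLETrace κ`)**: the complement
of `γ[0, t]` in `ℍ` has no bounded connected component, i.e. it coincides with (the union of) its
unbounded component(s), the Loewner domain. [cite: RohdeSchramm2005, Thm 6.4] -/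
theorem ae_forall_domain_eq_of_eight_le (hγ : HasSLETrace κ) (hκ : 8 ≤ κ) :
    ∀ᵐ ω ∂Process.preWienerMeasure, ∀ t : ℝ≥0,
      domain (sleDriving κ ω) t = upperHalfPlaneSet \ sleTrace κ ω '' Icc 0 t := by
  filter_upwards [ae_forall_sleHull_eq_of_eight_le hγ hκ] with ω hω
  intro t
  rw [domain, show hull (sleDriving κ ω) t = sleHull κ ω t from rfl, hω t]
  ext w
  simp only [Set.mem_sdiff, mem_inter_iff, not_and]
  exact ⟨fun ⟨hw, h⟩ ↦ ⟨hw, h hw⟩, fun ⟨hw, h⟩ ↦ ⟨hw, fun _ ↦ h⟩⟩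

end Literature.Probability.RandomPlanarGeometry

end
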